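import Mathlib
import Summits.Ventures.PercRepro2.TypedPendantA3AtB
import Summits.Ventures.PercRepro2.TypedPendantA3AtOWeighted

/-!
# The pendant `a₃` at `b`, weighted: `Gc(p) = (1 − t²)·Gc(p₀) + t²·Gc(p₁) − t(1 − t)·X_w` (blind
cell PercRepro2, mine-2 g54, 2026-08-29; `conjectures/MINE-2.md` M2-117 add. 1)

The typed row `(N₀, 3N₀ − X, 2N₀ + N₃ − X, N₃)` of a pendant `a₃` at `b`
(`TypedPendantA3AtB.lean`) lifts to every weight vector through p1's pinning recursion, as the rows
at `o` and at the roots did: the Bernstein weights `(1 − t)³, t(1 − t)², t²(1 − t), t³` on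
`N₀, 3N₀ − X, 2N₀ + N₃ − X, N₃` sum to `(1 − t²)·N₀ + t²·N₃ − t(1 − t)·X`, hence for `f ∉ F`

  **`triSum_pendant_a3_at_b`**:
  `triSum p F τ K₃ = (1 − t²)·triSum p₀ F τ K₃ + t²·triSum p₁ F τ K₃ − t(1 − t)·triSum p₀ F τ X`

(`t = p f`, `p₀ = p[f := 0]`, `p₁ = p[f := 1]`, `X` the spectator-side-selected root-row
covariance kernel), and with `F = ∅` (`hcov_cubic`) **`Gc_pendant_a3_at_b`** — the weighted row
«`a₃` at `b`» of `conjectures/MINE-2-RULES.md` (Thm 20, there on `K₅`: `(1−t)²·I + 2t(1−t)·(…) +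
t²·(…)`) on every finite graph, with the three coefficients identified as `Gc` with the leaf
removed, `Gc` with `b = a₃` merged, and the covariance term.  Characteristic `0` as in the typed
row.  Own work; standard axioms.
-/

namespace Summit.Ventures.PercRepro2

namespace CovForm

namespace TypedRed

open OneTyped

section Weighted

open Classical

variable {V : Type*} {E : Type*} [Fintype E] [DecidableEq E] {R : Type*} [Field R]
variable (ends : E → Sym2 V) (o a₁ a₂ a₃ b : V)

/-- **The base case at `b`**: every free edge other than `f` pinned. -/
lemma triSum_pendant_a3_at_b_pinned [CharZero R] {f : E} (hf : ends f = s(a₃, b))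
    (hleaf : ∀ e, a₃ ∈ ends e → e = f) (h3b : a₃ ≠ b) (h3o : a₃ ≠ o) (h31 : a₃ ≠ a₁)
    (h32 : a₃ ≠ a₂) (p : E → R) (F : Finset E) (hfF : f ∉ F)
    (hq : ∀ e, e ∉ insert f F → p e = 0 ∨ p e = 1) (τ : E → ℕ) :
    triSum p F τ (K3 ends o a₁ a₂ a₃ b : Config E → Config E → Config E → R) =
      (1 - p f ^ 2) * triSum (Function.update p f 0) F τ (K3 ends o a₁ a₂ a₃ b) +
        p f ^ 2 * triSum (Function.update p f 1) F τ (K3 ends o a₁ a₂ a₃ b) -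
        p f * (1 - p f) * triSum (Function.update p f 0) F τ (fun x y w =>
          iQ ends a₁ a₂ x * (iH ends a₂ b x *
            TypedA3.covKer ends a₁ a₂ (iL ends a₁ o) (sigma ends a₁ a₂ b) y w -
            iL ends a₁ b x *
              TypedA3.covKer ends a₁ a₂ (iH ends a₂ o) (sigma ends a₁ a₂ b) y w)) := by
  have hfF' : f ∈ insert f F := Finset.mem_insert_self f F
  have hne : ∀ e ∈ F, e ≠ f := fun e he => ne_of_mem_of_not_mem he hfF
  have hq0 : ∀ e, e ∉ F → Function.update p f 0 e = 0 ∨ Function.update p f 0 e = 1 := by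
    intro e he
    by_cases h : e = f
    · subst h; left; simp
    · rw [Function.update_of_ne h]
      exact hq e (by simp [he, h])
  have hq1 : ∀ e, e ∉ F → Function.update p f 1 e = 0 ∨ Function.update p f 1 e = 1 := by
    intro e he
    by_cases h : e = f
    · subst h; right; simp
    · rw [Function.update_of_ne h]
      exact hq e (by simp [he, h])
  set P0 : R := ∏ e ∈ F, p e ^ τ e * (1 - p e) ^ (3 - τ e) with hP0
  have hprod : ∀ k : ℕ, (∏ e ∈ F, p e ^ Function.update τ f k e *
      (1 - p e) ^ (3 - Function.update τ f k e)) = P0 := fun k =>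
    Finset.prod_congr rfl fun e he => by rw [Function.update_of_ne (hne e he)]
  have hprod0 : (∏ e ∈ F, Function.update p f 0 e ^ τ e *
      (1 - Function.update p f 0 e) ^ (3 - τ e)) = P0 :=
    Finset.prod_congr rfl fun e he => by rw [Function.update_of_ne (hne e he)]
  have hprod1 : (∏ e ∈ F, Function.update p f 1 e ^ τ e *
      (1 - Function.update p f 1 e) ^ (3 - τ e)) = P0 :=
    Finset.prod_congr rfl fun e he => by rw [Function.update_of_ne (hne e he)]
  set Kc : Config E → Config E → Config E → R := fun x y w =>
    iQ ends a₁ a₂ x * (iH ends a₂ b x *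
      TypedA3.covKer ends a₁ a₂ (iL ends a₁ o) (sigma ends a₁ a₂ b) y w -
      iL ends a₁ b x * TypedA3.covKer ends a₁ a₂ (iH ends a₂ o) (sigma ends a₁ a₂ b) y w) with hKc
  set T₀ : R := typedCount F (Function.update (pinnedConfig p) f false) τ
    (K3 ends o a₁ a₂ a₃ b) with hT₀
  set C₀ : R := typedCount F (Function.update (pinnedConfig p) f false) τ Kc with hC₀
  have hT0 : typedCount (insert f F) (pinnedConfig p) (Function.update τ f 0)
      (K3 ends o a₁ a₂ a₃ b : Config E → Config E → Config E → R) = T₀ := by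
    rw [typedCount_type_zero (insert f F) f hfF' _ _ (Function.update_self f 0 τ),
      Finset.erase_insert hfF, hT₀]
    exact typedCount_congr_τ _ _ (fun e he => Function.update_of_ne (hne e he) _ _) _
  have hC0 : typedCount (insert f F) (pinnedConfig p) (Function.update τ f 0) Kc = C₀ := by
    rw [typedCount_type_zero (insert f F) f hfF' _ _ (Function.update_self f 0 τ),
      Finset.erase_insert hfF, hC₀]
    exact typedCount_congr_τ _ _ (fun e he => Function.update_of_ne (hne e he) _ _) _
  set T₁ : R := typedCount F (Function.update (pinnedConfig p) f true) τ
    (K3 ends o a₁ a₂ a₃ b) with hT₁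
  have hT3 : typedCount (insert f F) (pinnedConfig p) (Function.update τ f 3)
      (K3 ends o a₁ a₂ a₃ b : Config E → Config E → Config E → R) = T₁ := by
    rw [typedCount_type_three (insert f F) f hfF' _ _ (Function.update_self f 3 τ),
      Finset.erase_insert hfF, hT₁]
    exact typedCount_congr_τ _ _ (fun e he => Function.update_of_ne (hne e he) _ _) _
  have hT2 := typedCount_pendant_a3_at_b_two (R := R) ends o a₁ a₂ a₃ b hf hleaf h3b h3o h31 h32
    (insert f F) hfF' (pinnedConfig p) τ
  have hT1 := typedCount_pendant_a3_at_b_one (R := R) ends o a₁ a₂ a₃ b hf hleaf h3b h3o h31 h32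
    (insert f F) hfF' (pinnedConfig p) τ
  rw [← hKc, hC0, hT0, hT3] at hT2
  rw [← hKc, hC0, hT0] at hT1
  rw [triSum_pin p hfF τ, triSum_pinned_eq p (insert f F) hq, triSum_pinned_eq p (insert f F) hq,
    triSum_pinned_eq _ F hq0, triSum_pinned_eq _ F hq1, triSum_pinned_eq _ F hq0,
    Finset.prod_insert hfF, Finset.prod_insert hfF, hprod, hprod, hprod0, hprod1,
    pinnedConfig_update_zero, pinnedConfig_update_one, hT1, hT2, ← hT₀, ← hC₀, ← hT₁,
    Function.update_self, Function.update_self]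
  ring

/-- **The weighted pendant `a₃` at `b`**: for a typed edge set `F` not containing the leaf edge
`f = {a₃, b}`, every typed three-copy sum of `K₃` is `(1 − t²)·M₀ + t²·M₁ − t(1 − t)·X_w` with
`t = p f`, `M₀` / `M₁` the sums with `f` pinned closed / open and `X_w` the sum, with `f` pinned
closed, of the `X`-kernel of `TypedPendantA3AtB.lean`. -/
theorem triSum_pendant_a3_at_b [CharZero R] {f : E} (hf : ends f = s(a₃, b))
    (hleaf : ∀ e, a₃ ∈ ends e → e = f) (h3b : a₃ ≠ b) (h3o : a₃ ≠ o) (h31 : a₃ ≠ a₁)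
    (h32 : a₃ ≠ a₂) (p : E → R) (F : Finset E) (hfF : f ∉ F) (τ : E → ℕ) :
    triSum p F τ (K3 ends o a₁ a₂ a₃ b : Config E → Config E → Config E → R) =
      (1 - p f ^ 2) * triSum (Function.update p f 0) F τ (K3 ends o a₁ a₂ a₃ b) +
        p f ^ 2 * triSum (Function.update p f 1) F τ (K3 ends o a₁ a₂ a₃ b) -
        p f * (1 - p f) * triSum (Function.update p f 0) F τ (fun x y w =>
          iQ ends a₁ a₂ x * (iH ends a₂ b x *
            TypedA3.covKer ends a₁ a₂ (iL ends a₁ o) (sigma ends a₁ a₂ b) y w -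
            iL ends a₁ b x *
              TypedA3.covKer ends a₁ a₂ (iH ends a₂ o) (sigma ends a₁ a₂ b) y w)) := by
  generalize hn : (triFracFree p (insert f F)).card = n
  induction n using Nat.strong_induction_on generalizing p F τ with
  | _ n ih =>
    by_cases h0 : triFracFree p (insert f F) = ∅
    · apply triSum_pendant_a3_at_b_pinned ends o a₁ a₂ a₃ b hf hleaf h3b h3o h31 h32 p F hfF _ τ
      intro e he
      by_contra hc
      rw [not_or] at hc
      have : e ∈ triFracFree p (insert f F) := mem_triFracFree.mpr ⟨he, hc.1, hc.2⟩
      rw [h0] at this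
      exact absurd this (Finset.notMem_empty e)
    · obtain ⟨e, he⟩ := Finset.nonempty_iff_ne_empty.mpr h0
      have heF : e ∉ insert f F := (mem_triFracFree.mp he).1
      have hef : e ≠ f := fun h => heF (h ▸ Finset.mem_insert_self f F)
      have heF' : e ∉ F := fun h => heF (Finset.mem_insert_of_mem h)
      have hfF' : f ∉ insert e F := by
        rw [Finset.mem_insert, not_or]
        exact ⟨hef.symm, hfF⟩
      have hlt : ((triFracFree p (insert f F)).erase e).card < n := by
        rw [← hn]
        exact Finset.card_erase_lt_of_mem he
      have hc0 : (triFracFree (Function.update p e 0) (insert f F)).card =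
          ((triFracFree p (insert f F)).erase e).card := by
        rw [triFracFree_update p (insert f F) e 0 (Or.inl rfl)]
      have hc1 : (triFracFree (Function.update p e 1) (insert f F)).card =
          ((triFracFree p (insert f F)).erase e).card := by
        rw [triFracFree_update p (insert f F) e 1 (Or.inr rfl)]
      have hc2 : (triFracFree p (insert f (insert e F))).card =
          ((triFracFree p (insert f F)).erase e).card := by
        rw [Finset.insert_comm, triFracFree_insert]
      have h1 := ih _ hlt (Function.update p e 0) F hfF τ hc0
      have h2 := ih _ hlt (Function.update p e 1) F hfF τ hc1
      have h3 := ih _ hlt p (insert e F) hfF' (Function.update τ e 1) hc2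
      have h4 := ih _ hlt p (insert e F) hfF' (Function.update τ e 2) hc2
      rw [triSum_pin p heF' τ, triSum_pin (Function.update p f 0) heF' τ,
        triSum_pin (Function.update p f 1) heF' τ, triSum_pin (Function.update p f 0) heF' τ,
        h1, h2, h3, h4, Function.update_of_ne hef.symm, Function.update_of_ne hef.symm,
        Function.update_of_ne hef, Function.update_of_ne hef, Function.update_comm hef,
        Function.update_comm hef, Function.update_comm hef, Function.update_comm hef]
      ring

variable [LinearOrder R] [IsStrictOrderedRing R]

/-- **(HCOV)'s cubic form at a pendant `a₃` at `b`**: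
`Gc p = (1 − t²)·Gc p₀ + t²·Gc p₁ − t(1 − t)·E_{p₀}[X-spectator]`, more precisely the last term is
`t(1 − t)` times the cubic form of the `X`-kernel under `p₀` (`t = p f`, `p₀ = p[f := 0]`,
`p₁ = p[f := 1]`). -/
theorem Gc_pendant_a3_at_b [CharZero R] {f : E} (hf : ends f = s(a₃, b))
    (hleaf : ∀ e, a₃ ∈ ends e → e = f) (h3b : a₃ ≠ b) (h3o : a₃ ≠ o) (h31 : a₃ ≠ a₁)
    (h32 : a₃ ≠ a₂) (p : E → R) :
    Gc p ends o a₁ a₂ a₃ b =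
      (1 - p f ^ 2) * Gc (Function.update p f 0) ends o a₁ a₂ a₃ b +
        p f ^ 2 * Gc (Function.update p f 1) ends o a₁ a₂ a₃ b -
        p f * (1 - p f) * triSum (Function.update p f 0) ∅ (fun _ => 0) (fun x y w =>
          iQ ends a₁ a₂ x * (iH ends a₂ b x *
            TypedA3.covKer ends a₁ a₂ (iL ends a₁ o) (sigma ends a₁ a₂ b) y w -
            iL ends a₁ b x *
              TypedA3.covKer ends a₁ a₂ (iH ends a₂ o) (sigma ends a₁ a₂ b) y w)) := by
  rw [hcov_cubic p ends o a₁ a₂ a₃ b (fun _ => 0),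
    hcov_cubic (Function.update p f 0) ends o a₁ a₂ a₃ b (fun _ => 0),
    hcov_cubic (Function.update p f 1) ends o a₁ a₂ a₃ b (fun _ => 0)]
  exact triSum_pendant_a3_at_b ends o a₁ a₂ a₃ b hf hleaf h3b h3o h31 h32 p ∅
    (Finset.notMem_empty f) (fun _ => 0)

end Weighted

end TypedRed

end CovForm

end Summit.Ventures.PercRepro2
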